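import Literature.MathematicalPhysics.QuantumFieldTheory.Balaban1983to89.B9Eq3152StoreyHValueMemberClosed
import Literature.MathematicalPhysics.QuantumFieldTheory.Balaban1983to89.B9Eq343GreenPrimeDstarHolderRowTowerOfFlatWindow

/-!
# `Balaban1983to89.B9Eq3152StoreyHOfFlatWindowLetter` — T. Bałaban, *Propagators for lattice gauge theories in a background field*, Commun. Math. Phys. **99** (1985)
# 389–434 [Balaban1985BackgroundPropagators] Thm 3.13 p. 426, Thm 3.1 (3.42)–(3.44) pp. 397–398, with [Balaban1985Variational] (117) p. 295: **STOREY H WITH (HLaH) REDUCED TO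
# THE ONE WINDOWED FLAT LETTER — (HLaH) = [B9] Thm 3.1 (3.43)₂ for `G′_kD*_U` on the model ⇐ `HflatW` (the two-point letter of the FLAT resolvent `(L₀+1)⁻¹∂*` on
# `T_{(L^{n+1}m)}` with `cosh` weights of rate `a` inside the Combes–Thomas window `2d(L^{n+1})²(cosh a − 1) ≤ ½`, [B4] (1.9) at `A = 0`, displayed), hence the (117) socket
# for the FULL `𝔊̃_k` ON THE MODEL ⇐ `HflatW` ∧ (HLb)** — NE9 crux-team LEAF PROVER 01, gen 93.  THIS FILE SUPERSEDES `B9Eq3152StoreyHOfFlatLetter` (same bookkeeping), whose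
# unwindowed flat letter is not satisfiable uniformly in the periods (so those two theorems are vacuous) — see `B9Eq343ResolventHolderRowTowerOfFlatWindow`.

statement-level skeleton of published theorems with citation tags; proofs where landed; nothing here is a claim about the Yang–Mills mass gap

CITATION HEADER (lean-in-tree rule).  Audit cell `pub-balaban`, sub-cell `t4`, BINDER row NE9; filed by NE9 crux-team LEAF PROVER 01 (`b2b-balaban-t4-ne9-formalise-leaf-01`,
gen 93; bears_on: R4/N22).  Source READ first-hand (`paper:balaban1985-cmp99-background-propagators`, pp. 394, 396–398, 426).  COMPOSED BY NAME:
`B9Eq343GreenPrimeDstarHolderRowTowerOfFlatWindow.exists_holderRow_GpOfUk_covDiv_of_flatWindow` (gen 93: (3.43)₂ with decay for `G′_kD*_U` modulo `HflatW`) and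
`B9Eq3152StoreyHValueMemberClosed.exists_norm_toCLM115_frakGkPi_le_of_holderMember_hessian` (gen 93).  Nothing printed is a hypothesis except through `HflatW` and (HLb).

WHAT IS PROVED (sorry-free; proof lane — 0 `def`; [folklore] bookkeeping).
* **`holderMember_of_flatWindow`** — (HLaH) [the Hölder member of (HLa₀) on the (T4E) block, `ε := β`] ⇐ `HflatW`.
* **`exists_norm_toCLM115_frakGkPi_le_of_flatWindow_hessian`** — THE HEADLINE OF STOREY H with (HLaH) replaced by `HflatW`: the (117) socket
  `‖toCLM115 ∇_U 𝔊̃_k‖ ≤ max(w̄₀B, w̄₁B)·w̲⁻¹` for the FULL `𝔊̃_k` ⇐ `HflatW` ∧ (HLb).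
HONEST SCOPE.  After this file the (117) VALUE∕GRADIENT programme for `𝔊̃_k` on the MODEL rests on EXACTLY: `HflatW` = the η-scale two-point (Hölder, exponent `β ∈ ]0,1]`) row
of the FLAT unit-mass resolvent's adjoint `(L₀+1)⁻¹∂*` on the tori `T_{(L^{n+1}m)}` with `cosh` weights of rate `a ≤ L^{−(n+1)}` inside the window `2d(L^{n+1})²(cosh a − 1) ≤ ½`
(a discrete Calderón–Zygmund ∕ Schauder estimate for `∇(Δ+1)⁻¹∇*` at scale — [B4] (1.9) at `A = 0`, kernel-checked in lit-balaban on its equal-sided torus carrier only, NOT in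
this tree for general periods; expected for `β < 1`) and (HLb) = Thm 3.1 (3.44) for `G′_k` — both DISPLAYED, not supplied.  «NE9 ⇐ the named binders»; NE9 NOT PRINTED ∕ NOT
PROVED; row WALLED ON A MODEL (O-NE9-1; #5 UNRULED); spine PROVED 0∕9; rung (B)+1 finite T⁴ — NOT infinite volume, NOT mass gap, NOT BetaPertH, NOT Clay.  HONEST DEPENDENCY
(cell line): continuum YM on T⁴ ⇐ BetaPertH ∧ nine spine estimates (0/9 proved); BetaPertH ⇐ (D1) ∧ (D4) ∧ CAP+tail; G-an2-4 gates asym, D1 and NE2/3/4.  NEW file; nothing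
modified.  Net new unproved facts: 0.
-/

noncomputable section

set_option autoImplicit false

open scoped InnerProductSpace ComplexConjugate BigOperators

namespace Literature.MathematicalPhysics.QuantumFieldTheory.Balaban1983to89.B9Eq3152StoreyHOfFlatWindowLetter

open B4Sect5Torus (TSite tdist tdist_nonneg)
open B9SectCLatticeCarrier (Bond bpos btgt unshift)
open B9Eq311L2Pairing (WL2)
open B9Eq319QprimeTorus (fineP blockCoord)
open B7Prop1Explicit (U1 Wcx boxVec)
open B11Eq103H1Complex (SiteL2K BondL2K greenK covDerivL2K covDivL2K covLaplaceSiteK G1LatticeK frakGLatticeK)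
open B9Eq310DeltaPrime (plaqHolU)
open B9Eq310HessianOperator (adTransportW)
open B9Eq315QTorus (perCfg cornerSite)
open B9Eq315QTower (towerP UlevOf)
open B9Eq316TowerFlatIsOneStep (towerP_eq_fineP_pow siteCast)
open B9Eq326OperatorTower (QprimeTowerW RofUk laplaceAk QkW)
open B9Eq3119DeltaPiTower (laplaceAkPi)
open B9Eq324DeltaPrimeATower (laplacePrimeAk GpOfUk)
open B9Eq325ProjFormulaTower (QGGQk_pos_of_unitary)
open B9Eq33CovDerivVector (covGrad)
open B11Eq115Space (NegSup levWeight)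
open B11Eq111FrakG (toCLM115)
open B9Eq3152StoreyHTwoHolderMembers (exists_norm_toCLM115_frakGkPi_le_of_twoHolderMembers)
open B9Eq342GreenPrimeDstarValueRowTower (exists_valueRow_GpOfUk_covDiv)
open B4TorusKernel.MultiPeriod (circAbs)
open B9Eq343GreenPrimeDstarHolderRowTowerOfFlatWindow (exists_holderRow_GpOfUk_covDiv_of_flatWindow)
open B9Eq3152StoreyHValueMemberClosed (exists_norm_toCLM115_frakGkPi_le_of_holderMember_hessian)

variable {d : ℕ} (hd : 1 ≤ d) (L : ℕ) [NeZero L] (hL : 1 ≤ L) (hL3 : 3 ≤ L)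
  {𝔸 : Type*} [NormedRing 𝔸] [NormedAlgebra ℂ 𝔸] [CompleteSpace 𝔸] [NormOneClass 𝔸] [StarRing 𝔸] [NormedStarGroup 𝔸] [StarModule ℂ 𝔸]
  {W : Type*} [NormedAddCommGroup W] [InnerProductSpace ℂ W] [FiniteDimensional ℂ W] (φ : W ≃ₗ[ℂ] 𝔸)
  {Mφ Mφ' : ℝ} (hMφ : 0 ≤ Mφ) (hMφ' : 0 ≤ Mφ') (hφ : ∀ w, ‖φ w‖ ≤ Mφ * ‖w‖) (hφ' : ∀ X, ‖φ.symm X‖ ≤ Mφ' * ‖X‖) (hstar : ∀ X : 𝔸, ‖star X‖ ≤ ‖X‖)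
  {a : ℝ} (ha : 0 < a) {a' : ℝ} (ha' : 0 < a') {ϱ : ℝ} (hϱ0 : 0 ≤ ϱ) (hϱ1 : ϱ < 1)
  (τ : 𝔸 →ₗ[ℂ] ℂ) {Cτ : ℝ} (hτ : ∀ X, ‖τ X‖ ≤ Cτ * ‖X‖) (hCτ : 0 ≤ Cτ) {Mτ : ℝ} (hτm : ∀ X Y : 𝔸, ‖τ (X * Y)‖ ≤ Mτ * ‖X‖ * ‖Y‖) (hMτ : 0 ≤ Mτ)
  {ρw : ℝ} (hρw : 0 ≤ ρw)
  (hτ₁ : ∀ X : 𝔸, τ (star X) = conj (τ X)) (hτ₂ : ∀ X Y : 𝔸, τ (X * Y) = τ (Y * X)) (hφτ : ∀ X Y : 𝔸, ⟪φ.symm X, φ.symm Y⟫_ℂ = τ (star X * Y))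
  (AQ : ℝ)

set_option maxHeartbeats 800000 in -- one ≈ 50-binder block
omit [NormedStarGroup 𝔸] in
include hd hL3 hMφ hMφ' hφ hφ' ha' hϱ0 hϱ1 hτ₂ hφτ in
/-- **(HLaH) ⇐ `HflatW`: the Hölder member of (HLa₀) for `G′_kD*_U` on the (T4E) block, exponent `ε := β`**, from H-D's
`exists_holderRow_GpOfUk_covDiv_of_flatWindow` read on the block. [folklore] [cite: Balaban1985BackgroundPropagators, Thm 3.1 (3.43) p.398, (3.40) p.397, (3.24)–(3.25) p.394] -/
theorem holderMember_of_flatWindow {β : ℝ} (hβ0 : 0 < β) (hβ1 : β ≤ 1) (SH : ℝ) (hSH : 0 ≤ SH)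
    (HflatW : ∀ (n : ℕ) (η : ℝ), η * (L : ℝ) ^ (n + 1) = 1 → ∀ (c₀ : ℝ) [Fact (0 < c₀)] (m : Fin d → ℕ) [∀ i, NeZero (m i)] (a : ℝ), 0 ≤ a →
      a * (L : ℝ) ^ (n + 1) ≤ 1 → 2 * (d : ℝ) * ((L : ℝ) ^ (n + 1)) ^ 2 * (Real.cosh a - 1) ≤ 1 / 2 →
      ∀ (x₀ : TSite d (towerP L m (n + 1))) (u : SiteL2K ℂ d (towerP L m (n + 1)) c₀ W) (f : BondL2K ℂ d (towerP L m (n + 1)) c₀ W) (F : ℝ),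
      0 ≤ F → covLaplaceSiteK ((η⁻¹ : ℝ) : ℂ) (fun _ : Bond d (towerP L m (n + 1)) => (LinearMap.id : W →ₗ[ℂ] W)) (fun _ => LinearMap.id) u + ((1 : ℝ) : ℂ) • u =
        covDivL2K ℂ c₀ ((η⁻¹ : ℝ) : ℂ) (fun _ : Bond d (towerP L m (n + 1)) => (LinearMap.id : W →ₗ[ℂ] W)) f →
      (∀ b, ‖WL2.equiv ℂ (fun _ : Bond d (towerP L m (n + 1)) => c₀) W f b‖ ≤ F * ∏ μ, Real.cosh (a * (circAbs (towerP L m (n + 1) μ) ((((x₀ μ : ℕ) : ZMod (towerP L m (n + 1) μ)) - ((bpos b μ : ℕ) : ZMod (towerP L m (n + 1) μ))).val) : ℝ))) →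
      ∀ x x', tdist (towerP L m (n + 1)) x x' ≤ (L : ℝ) ^ (n + 1) →
        ‖WL2.equiv ℂ (fun _ : TSite d (towerP L m (n + 1)) => c₀) W u x' - WL2.equiv ℂ (fun _ : TSite d (towerP L m (n + 1)) => c₀) W u x‖ ≤
          SH * F * (tdist (towerP L m (n + 1)) x x' / (L : ℝ) ^ (n + 1)) ^ β * ∏ μ, Real.cosh (a * (circAbs (towerP L m (n + 1) μ) ((((x₀ μ : ℕ) : ZMod (towerP L m (n + 1) μ)) - ((x μ : ℕ) : ZMod (towerP L m (n + 1) μ))).val) : ℝ))) :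
    ∃ ε αa Ba δa : ℝ, 0 < ε ∧ ε ≤ 1 ∧ 0 < αa ∧ 0 ≤ Ba ∧ 0 < δa ∧
      ∀ (n : ℕ) (η : ℝ) (_hηL : η * (L : ℝ) ^ (n + 1) = 1) (c₀ c₁ : ℝ) [Fact (0 < c₀)] [Fact (0 < c₁)]
        (_hw : c₀ * ((L : ℝ) ^ (n + 1)) ^ d = c₁) (_hρ : |η| ^ d / c₀ ≤ ρw) (m : Fin d → ℕ) [∀ i, NeZero (m i)] (_hm : ∀ i, 1 ≤ m i)
        (U : Bond d (towerP L m (n + 1)) → 𝔸ˣ) (αU : ℕ → ℝ) (_hα0 : ∀ j, 0 ≤ αU j) (hα1 : ∀ j, αU j ≤ 1 / 64)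
        (hU1 : ∀ (j : ℕ) (x : B7Prop1Explicit.Site d) (k : Fin d), perCfg (towerP L m (j + 1)) (UlevOf L m (n + 1) U j) x k ∈ U1 𝔸)
        (hreg : ∀ (j : ℕ) (y : TSite d (towerP L m j)) (k : Fin d) (ρ' : Fin d → Fin L),
          ‖((Wcx L (perCfg (towerP L m (j + 1)) (UlevOf L m (n + 1) U j)) (cornerSite L y) k (boxVec L ρ') : 𝔸ˣ) : 𝔸) - 1‖ ≤ αU j)
        (εU : ℕ → ℝ) (_hεU : ∀ j, 0 ≤ εU j) (_hUε : ∀ (j : ℕ) (b : Bond d (towerP L m (j + 1))), ‖(UlevOf L m (n + 1) U j b : 𝔸) - 1‖ ≤ εU j)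
        (_hLb : ∀ (j : ℕ) (b : Bond d (towerP L m (j + 1))), UlevOf L m (n + 1) U j b ∈ U1 𝔸)
        (α : ℝ) (_hα : 0 ≤ α) (_hαle : α ≤ αa)
        (hUst : ∀ b, star (U b : 𝔸) = (((U b)⁻¹ : 𝔸ˣ) : 𝔸)) (_hUb : ∀ b, U b ∈ U1 𝔸) (_hUη : ∀ b, ‖(U b : 𝔸) - 1‖ ≤ α * η)
        (_hpl : ∀ p : B9SectCLatticeCarrier.Plaq d (towerP L m (n + 1)), ‖(plaqHolU U p : 𝔸) - 1‖ ≤ α * η ^ 2)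
        (_hUgrad : ∀ (x : TSite d (towerP L m (n + 1))) (μ : Fin d), ‖(U (x, μ) : 𝔸) - U (unshift μ x, μ)‖ ≤ α * η ^ 2)
        (_hRlev : ∀ (j : ℕ) (b : Bond d (towerP L m (j + 1))) (w : W), ‖adTransportW φ (UlevOf L m (n + 1) U j) b w‖ ≤ ‖w‖)
        (_hεg : ∀ j < n + 1, εU j ≤ α * ϱ ^ j) (_hAQ : ∑ j ∈ Finset.range (n + 1), αU j ≤ AQ)
        (hpos' : ∀ x : SiteL2K ℂ d (towerP L m (n + 1)) c₀ W, x ≠ 0 → 0 < RCLike.re ⟪x, laplacePrimeAk L m n φ η U a' (c₁ := c₁) x⟫_ℂ)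
        (hpos : ∀ x : BondL2K ℂ d (towerP L m (n + 1)) c₀ W, x ≠ 0 →
          0 < RCLike.re ⟪x, laplaceAk L m n φ η U hL αU hα1 hU1 hreg τ (c₀ := c₀) (c₁ := c₁) a x⟫_ℂ)
        (hposπ : ∀ x : BondL2K ℂ d (towerP L m (n + 1)) c₀ W, x ≠ 0 →
          0 < RCLike.re ⟪x, laplaceAkPi L m n φ τ η U a' hpos' hL αU hα1 hU1 hreg (c₁ := c₁) a x⟫_ℂ)
        (_hc₀ : c₀ = η ^ d)
        (_hJ : ∀ (μ : Fin d) (y : TSite d (towerP L m (n + 1))),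
          ‖B9Eq39Adjoint.J (fun μ => B9Eq33CovDerivVector.shiftEquiv μ) (fun μ y => U (y, μ)) η μ y‖ ≤ α)
        (v : TSite d m) (f : BondL2K ℂ d (towerP L m (n + 1)) c₀ W) (F : ℝ)
        (_hfv : ∀ b, blockCoord (L ^ (n + 1)) m (siteCast (towerP_eq_fineP_pow L m (n + 1)) (bpos b)) ≠ v →
          WL2.equiv ℂ (fun _ : Bond d (towerP L m (n + 1)) => c₀) W f b = 0)
        (_hfF : ∀ b, ‖WL2.equiv ℂ (fun _ : Bond d (towerP L m (n + 1)) => c₀) W f b‖ ≤ F) (x : TSite d (towerP L m (n + 1))),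
        ∀ x' : TSite d (towerP L m (n + 1)), tdist (towerP L m (n + 1)) x x' ≤ ((L ^ (n + 1) : ℕ) : ℝ) →
          ‖WL2.equiv ℂ (fun _ : TSite d (towerP L m (n + 1)) => c₀) W (GpOfUk L m n φ η U a' (c₁ := c₁) hpos' (covDivL2K ℂ c₀ ((η : ℂ))⁻¹ (adTransportW φ fun bb => (U bb)⁻¹) f)) x' - WL2.equiv ℂ (fun _ : TSite d (towerP L m (n + 1)) => c₀) W (GpOfUk L m n φ η U a' (c₁ := c₁) hpos' (covDivL2K ℂ c₀ ((η : ℂ))⁻¹ (adTransportW φ fun bb => (U bb)⁻¹) f)) x‖ ≤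
            Ba * Real.exp (-(δa * tdist m (blockCoord (L ^ (n + 1)) m (siteCast (towerP_eq_fineP_pow L m (n + 1)) x)) v)) * (tdist (towerP L m (n + 1)) x x' / ((L ^ (n + 1) : ℕ) : ℝ)) ^ ε * F := by
  obtain ⟨αh, Bh, δh, hαh, hBh, hδh, HH⟩ :=
    exists_holderRow_GpOfUk_covDiv_of_flatWindow L hL3 φ hMφ hMφ' hφ hφ' ha' hϱ0 hϱ1 τ hτ₂ hφτ hd hβ0 hβ1 SH hSH HflatW
  refine ⟨β, αh, Bh, δh, hβ0, hβ1, hαh, hBh, hδh, ?_⟩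
  intro n η hηL c₀ c₁ _ _ hw _ m _ _ U αU _ hα1 hU1 hreg εU hεU hUε hLb α hα hαle hUst hUb hUη _ hUgrad hRlev hεg _ hpos' _ _ _ _ v f F hfv hfF x x' hxx
  rw [Nat.cast_pow] at hxx ⊢
  exact HH n η hηL c₀ c₁ hw m U α hα hαle hUb hUη hUgrad εU hεU hεg hUε hLb hUst hRlev hpos' v f F hfv hfF x x' hxx

set_option maxHeartbeats 800000 in -- three ≈ 50-binder blocks
include hd hL hL3 hMφ hMφ' hφ hφ' hstar ha ha' hϱ0 hϱ1 hτ hCτ hτm hMτ hρw hτ₁ hτ₂ hφτ in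
/-- **THE HEADLINE OF STOREY H WITH (HLaH) REDUCED TO THE WINDOWED FLAT LETTER: the (117) socket `‖toCLM115 ∇_U 𝔊̃_k‖ ≤ max(w̄₀B, w̄₁B)·w̲⁻¹` for the FULL `𝔊̃_k` ON THE MODEL from
`HflatW` (the windowed two-point letter of the flat resolvent) and (HLb) = Thm 3.1 (3.44) for `G′_k`** — F-D's `exists_norm_toCLM115_frakGkPi_le_of_holderMember_hessian` with
(HLaH) := `holderMember_of_flatWindow HflatW`.
[cite: Balaban1985Variational, (117) p.295; Balaban1985BackgroundPropagators, Thm 3.13 p.426, Thm 3.1 (3.42)–(3.44) pp.397–398, (3.152)–(3.153) p.426, (3.25) p.394] -/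
theorem exists_norm_toCLM115_frakGkPi_le_of_flatWindow_hessian {β : ℝ} (hβ0 : 0 < β) (hβ1 : β ≤ 1) (SH : ℝ) (hSH : 0 ≤ SH)
    (HflatW : ∀ (n : ℕ) (η : ℝ), η * (L : ℝ) ^ (n + 1) = 1 → ∀ (c₀ : ℝ) [Fact (0 < c₀)] (m : Fin d → ℕ) [∀ i, NeZero (m i)] (a : ℝ), 0 ≤ a →
      a * (L : ℝ) ^ (n + 1) ≤ 1 → 2 * (d : ℝ) * ((L : ℝ) ^ (n + 1)) ^ 2 * (Real.cosh a - 1) ≤ 1 / 2 →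
      ∀ (x₀ : TSite d (towerP L m (n + 1))) (u : SiteL2K ℂ d (towerP L m (n + 1)) c₀ W) (f : BondL2K ℂ d (towerP L m (n + 1)) c₀ W) (F : ℝ),
      0 ≤ F → covLaplaceSiteK ((η⁻¹ : ℝ) : ℂ) (fun _ : Bond d (towerP L m (n + 1)) => (LinearMap.id : W →ₗ[ℂ] W)) (fun _ => LinearMap.id) u + ((1 : ℝ) : ℂ) • u =
        covDivL2K ℂ c₀ ((η⁻¹ : ℝ) : ℂ) (fun _ : Bond d (towerP L m (n + 1)) => (LinearMap.id : W →ₗ[ℂ] W)) f →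
      (∀ b, ‖WL2.equiv ℂ (fun _ : Bond d (towerP L m (n + 1)) => c₀) W f b‖ ≤ F * ∏ μ, Real.cosh (a * (circAbs (towerP L m (n + 1) μ) ((((x₀ μ : ℕ) : ZMod (towerP L m (n + 1) μ)) - ((bpos b μ : ℕ) : ZMod (towerP L m (n + 1) μ))).val) : ℝ))) →
      ∀ x x', tdist (towerP L m (n + 1)) x x' ≤ (L : ℝ) ^ (n + 1) →
        ‖WL2.equiv ℂ (fun _ : TSite d (towerP L m (n + 1)) => c₀) W u x' - WL2.equiv ℂ (fun _ : TSite d (towerP L m (n + 1)) => c₀) W u x‖ ≤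
          SH * F * (tdist (towerP L m (n + 1)) x x' / (L : ℝ) ^ (n + 1)) ^ β * ∏ μ, Real.cosh (a * (circAbs (towerP L m (n + 1) μ) ((((x₀ μ : ℕ) : ZMod (towerP L m (n + 1) μ)) - ((x μ : ℕ) : ZMod (towerP L m (n + 1) μ))).val) : ℝ)))
    (HLb : ∀ ε : ℝ, 0 < ε → ε ≤ 1 → ∃ αb Bb δb : ℝ, 0 < αb ∧ 0 ≤ Bb ∧ 0 < δb ∧
      ∀ (n : ℕ) (η : ℝ) (_hηL : η * (L : ℝ) ^ (n + 1) = 1) (c₀ c₁ : ℝ) [Fact (0 < c₀)] [Fact (0 < c₁)]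
        (_hw : c₀ * ((L : ℝ) ^ (n + 1)) ^ d = c₁) (_hρ : |η| ^ d / c₀ ≤ ρw) (m : Fin d → ℕ) [∀ i, NeZero (m i)] (_hm : ∀ i, 1 ≤ m i)
        (U : Bond d (towerP L m (n + 1)) → 𝔸ˣ) (αU : ℕ → ℝ) (_hα0 : ∀ j, 0 ≤ αU j) (hα1 : ∀ j, αU j ≤ 1 / 64)
        (hU1 : ∀ (j : ℕ) (x : B7Prop1Explicit.Site d) (k : Fin d), perCfg (towerP L m (j + 1)) (UlevOf L m (n + 1) U j) x k ∈ U1 𝔸)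
        (hreg : ∀ (j : ℕ) (y : TSite d (towerP L m j)) (k : Fin d) (ρ' : Fin d → Fin L),
          ‖((Wcx L (perCfg (towerP L m (j + 1)) (UlevOf L m (n + 1) U j)) (cornerSite L y) k (boxVec L ρ') : 𝔸ˣ) : 𝔸) - 1‖ ≤ αU j)
        (εU : ℕ → ℝ) (_hεU : ∀ j, 0 ≤ εU j) (_hUε : ∀ (j : ℕ) (b : Bond d (towerP L m (j + 1))), ‖(UlevOf L m (n + 1) U j b : 𝔸) - 1‖ ≤ εU j)
        (_hLb : ∀ (j : ℕ) (b : Bond d (towerP L m (j + 1))), UlevOf L m (n + 1) U j b ∈ U1 𝔸)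
        (α : ℝ) (_hα : 0 ≤ α) (_hαle : α ≤ αb)
        (hUst : ∀ b, star (U b : 𝔸) = (((U b)⁻¹ : 𝔸ˣ) : 𝔸)) (_hUb : ∀ b, U b ∈ U1 𝔸) (_hUη : ∀ b, ‖(U b : 𝔸) - 1‖ ≤ α * η)
        (_hpl : ∀ p : B9SectCLatticeCarrier.Plaq d (towerP L m (n + 1)), ‖(plaqHolU U p : 𝔸) - 1‖ ≤ α * η ^ 2)
        (_hUgrad : ∀ (x : TSite d (towerP L m (n + 1))) (μ : Fin d), ‖(U (x, μ) : 𝔸) - U (unshift μ x, μ)‖ ≤ α * η ^ 2)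
        (_hRlev : ∀ (j : ℕ) (b : Bond d (towerP L m (j + 1))) (w : W), ‖adTransportW φ (UlevOf L m (n + 1) U j) b w‖ ≤ ‖w‖)
        (_hεg : ∀ j < n + 1, εU j ≤ α * ϱ ^ j) (_hAQ : ∑ j ∈ Finset.range (n + 1), αU j ≤ AQ)
        (hpos' : ∀ x : SiteL2K ℂ d (towerP L m (n + 1)) c₀ W, x ≠ 0 → 0 < RCLike.re ⟪x, laplacePrimeAk L m n φ η U a' (c₁ := c₁) x⟫_ℂ)
        (hpos : ∀ x : BondL2K ℂ d (towerP L m (n + 1)) c₀ W, x ≠ 0 →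
          0 < RCLike.re ⟪x, laplaceAk L m n φ η U hL αU hα1 hU1 hreg τ (c₀ := c₀) (c₁ := c₁) a x⟫_ℂ)
        (hposπ : ∀ x : BondL2K ℂ d (towerP L m (n + 1)) c₀ W, x ≠ 0 →
          0 < RCLike.re ⟪x, laplaceAkPi L m n φ τ η U a' hpos' hL αU hα1 hU1 hreg (c₁ := c₁) a x⟫_ℂ)
        (_hc₀ : c₀ = η ^ d)
        (_hJ : ∀ (μ : Fin d) (y : TSite d (towerP L m (n + 1))),
          ‖B9Eq39Adjoint.J (fun μ => B9Eq33CovDerivVector.shiftEquiv μ) (fun μ y => U (y, μ)) η μ y‖ ≤ α)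
        (y' : TSite d m) (lam : SiteL2K ℂ d (towerP L m (n + 1)) c₀ W) (N H : ℝ) (_hN : 0 ≤ N) (_hH : 0 ≤ H)
        (_hsupp : ∀ x, WL2.equiv ℂ (fun _ : TSite d (towerP L m (n + 1)) => c₀) W lam x ≠ 0 → tdist m (blockCoord (L ^ (n + 1)) m (siteCast (towerP_eq_fineP_pow L m (n + 1)) x)) y' ≤ 1)
        (_hval : ∀ x, ‖WL2.equiv ℂ (fun _ : TSite d (towerP L m (n + 1)) => c₀) W lam x‖ ≤ N)
        (_hhol : ∀ x x' : TSite d (towerP L m (n + 1)), tdist (towerP L m (n + 1)) x x' ≤ ((L ^ (n + 1) : ℕ) : ℝ) →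
          ‖WL2.equiv ℂ (fun _ : TSite d (towerP L m (n + 1)) => c₀) W lam x' - WL2.equiv ℂ (fun _ : TSite d (towerP L m (n + 1)) => c₀) W lam x‖ ≤ H * (tdist (towerP L m (n + 1)) x x' / ((L ^ (n + 1) : ℕ) : ℝ)) ^ ε)
        (μ : Fin d) (b : Bond d (towerP L m (n + 1))),
        ‖WL2.equiv ℂ (fun _ : Bond d (towerP L m (n + 1)) => c₀) W (covDerivL2K ℂ c₀ ((η : ℂ))⁻¹ (adTransportW φ U)
            ((WL2.equiv ℂ (fun _ : TSite d (towerP L m (n + 1)) => c₀) W).symm fun y => WL2.equiv ℂ (fun _ : Bond d (towerP L m (n + 1)) => c₀) W (covDerivL2K ℂ c₀ ((η : ℂ))⁻¹ (adTransportW φ U) (GpOfUk L m n φ η U a' (c₁ := c₁) hpos' lam)) (y, μ))) b‖ ≤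
          Bb * Real.exp (-(δb * tdist m (blockCoord (L ^ (n + 1)) m (siteCast (towerP_eq_fineP_pow L m (n + 1)) (bpos b))) y')) * (N + H)) :
    ∃ α₁ j₁ B : ℝ, 0 < α₁ ∧ 0 < j₁ ∧ 0 ≤ B ∧
      ∀ (n : ℕ) (η : ℝ) (_hηL : η * (L : ℝ) ^ (n + 1) = 1) (c₀ c₁ : ℝ) [Fact (0 < c₀)] [Fact (0 < c₁)]
        (_hw : c₀ * ((L : ℝ) ^ (n + 1)) ^ d = c₁) (_hρ : |η| ^ d / c₀ ≤ ρw) (m : Fin d → ℕ) [∀ i, NeZero (m i)] (_hm : ∀ i, 1 ≤ m i)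
        (U : Bond d (towerP L m (n + 1)) → 𝔸ˣ) (αU : ℕ → ℝ) (_hα0 : ∀ j, 0 ≤ αU j) (hα1 : ∀ j, αU j ≤ 1 / 64)
        (hαL : ∀ j, 50 * (d + 1) * αU j * (L : ℝ) ^ d ≤ 1 / 2)
        (hU1 : ∀ (j : ℕ) (x : B7Prop1Explicit.Site d) (k : Fin d), perCfg (towerP L m (j + 1)) (UlevOf L m (n + 1) U j) x k ∈ U1 𝔸)
        (hreg : ∀ (j : ℕ) (y : TSite d (towerP L m j)) (k : Fin d) (ρ' : Fin d → Fin L),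
          ‖((Wcx L (perCfg (towerP L m (j + 1)) (UlevOf L m (n + 1) U j)) (cornerSite L y) k (boxVec L ρ') : 𝔸ˣ) : 𝔸) - 1‖ ≤ αU j)
        (εU : ℕ → ℝ) (_hεU : ∀ j, 0 ≤ εU j) (_hUε : ∀ (j : ℕ) (b : Bond d (towerP L m (j + 1))), ‖(UlevOf L m (n + 1) U j b : 𝔸) - 1‖ ≤ εU j)
        (_hLb : ∀ (j : ℕ) (b : Bond d (towerP L m (j + 1))), UlevOf L m (n + 1) U j b ∈ U1 𝔸)
        (α : ℝ) (_hα : 0 ≤ α) (_hαle : α ≤ α₁)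
        (hUst : ∀ b, star (U b : 𝔸) = (((U b)⁻¹ : 𝔸ˣ) : 𝔸)) (_hUb : ∀ b, U b ∈ U1 𝔸) (_hUη : ∀ b, ‖(U b : 𝔸) - 1‖ ≤ α * η)
        (_hpl : ∀ p : B9SectCLatticeCarrier.Plaq d (towerP L m (n + 1)), ‖(plaqHolU U p : 𝔸) - 1‖ ≤ α * η ^ 2)
        (_hUgrad : ∀ (x : TSite d (towerP L m (n + 1))) (μ : Fin d), ‖(U (x, μ) : 𝔸) - U (unshift μ x, μ)‖ ≤ α * η ^ 2)
        (_hRlev : ∀ (j : ℕ) (b : Bond d (towerP L m (j + 1))) (w : W), ‖adTransportW φ (UlevOf L m (n + 1) U j) b w‖ ≤ ‖w‖)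
        (_hεg : ∀ j < n + 1, εU j ≤ α * ϱ ^ j) (_hAQ : ∑ j ∈ Finset.range (n + 1), αU j ≤ AQ)
        (hpos' : ∀ x : SiteL2K ℂ d (towerP L m (n + 1)) c₀ W, x ≠ 0 → 0 < RCLike.re ⟪x, laplacePrimeAk L m n φ η U a' (c₁ := c₁) x⟫_ℂ)
        (hpos : ∀ x : BondL2K ℂ d (towerP L m (n + 1)) c₀ W, x ≠ 0 →
          0 < RCLike.re ⟪x, laplaceAk L m n φ η U hL αU hα1 hU1 hreg τ (c₀ := c₀) (c₁ := c₁) a x⟫_ℂ)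
        (_hc₀η : c₀ = η ^ d) (j₀ : ℝ) (_hJ : ∀ μ y, ‖B9Eq39Adjoint.J (fun μ => B9Eq33CovDerivVector.shiftEquiv μ) (fun μ y => U (y, μ)) η μ y‖ ≤ j₀) (_hj : j₀ ≤ j₁)
        (hposπ : ∀ x : BondL2K ℂ d (towerP L m (n + 1)) c₀ W, x ≠ 0 →
          0 < RCLike.re ⟪x, laplaceAkPi L m n φ τ η U a' hpos' hL αU hα1 hU1 hreg (c₁ := c₁) a x⟫_ℂ)
        (hQ : Function.Surjective (QkW L m n φ U hL αU hα1 hU1 hreg (c₀ := c₀) (c₁ := c₁)))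
        (Lw ηw : ℝ) [Fact (0 < Lw)] [Fact (0 < ηw)] (lev₀ : Bond d (towerP L m (n + 1)) → ℕ) (lev₁ : Bond d (towerP L m (n + 1)) × Fin d → ℕ),
        ‖toCLM115 (L := Lw) (η := ηw) (lev₀ := lev₀) lev₁ (covGrad ((η : ℂ))⁻¹ (adTransportW φ U))
            ((WL2.linearEquiv ℂ ℂ (fun _ : Bond d (towerP L m (n + 1)) => c₀)).toLinearMap ∘ₗ (frakGLatticeK hposπ hQ : _ →ₗ[ℂ] _) ∘ₗ
              ((WL2.linearEquiv ℂ ℂ (fun _ : Bond d (towerP L m (n + 1)) => c₀)).symm.toLinearMap :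
                (Bond d (towerP L m (n + 1)) → W) →ₗ[ℂ] BondL2K ℂ d (towerP L m (n + 1)) c₀ W))‖ ≤
          max ((NegSup.wSup (levWeight Lw ηw lev₀ 1) : ℝ) * B) (NegSup.wSup (levWeight Lw ηw lev₁ 2) * B) *
            NegSup.wInvSup (levWeight Lw ηw lev₀ 3) :=
  exists_norm_toCLM115_frakGkPi_le_of_holderMember_hessian hd L hL hL3 φ hMφ hMφ' hφ hφ' hstar ha ha' hϱ0 hϱ1 τ hτ hCτ hτm hMτ hρw hτ₁ hτ₂ hφτ AQ
    (holderMember_of_flatWindow hd L hL hL3 φ hMφ hMφ' hφ hφ' ha' hϱ0 hϱ1 τ hτ₂ hφτ AQ hβ0 hβ1 SH hSH HflatW) HLb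

end Literature.MathematicalPhysics.QuantumFieldTheory.Balaban1983to89.B9Eq3152StoreyHOfFlatWindowLetter

end
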